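import Summits.Ventures.YMGap.Thresholds.BallBracketsThree
import HarnessLib

/-!
# The ball-flux certificate beyond tilt `3`, series brackets on `0 ≤ κ ≤ 4` (for the pieces of rung 2/3)
(pub-ymgap track (a), A4-K kernel port) — strong-coupling bookkeeping for the slab area-law door; no mass-gap claim

HONEST FRAMING. This file extends the Taylor-bracket machinery of `BallBracketsTwo` / `BallBracketsThree` (themselves the
tree's `StrongCouplingTwelveSeventhsBrackets` pattern, pub-balaban) to the tilt range `0 ≤ κ ≤ 4`, i.e. to one-link laws
`ν_B` of `SU(2)` with `‖B‖_op ≤ 1` (Wilson `β_W ≤ 2/3` on the slab door of the cell, `6 β_W ≤ 4`).  Elementary real analysis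
about explicit power series; no statement about lattice measures, confinement or the mass gap.

WHAT THIS FILE PROVES.
* `exp_le_of_le_four`: `e^κ ≤ 5460/100` for `κ ≤ 4` (Mathlib's `Real.exp_one_lt_d9` to the fourth power).
* `sphere_bracket4` / `ball_bracket4` / `sphere_eval4` / `ball_eval4` / `ball_nonneg4`: two-sided Taylor brackets of
  `∫ x₀^k e^{κ x₀} dσ` and `∫₀¹ r^a ∫ x₀^k e^{κ r x₀} dσ dr` on `0 ≤ κ ≤ K ≤ 4`, tail constant `5460/100`.
* `moments_four`: the Haar moments `m₀ … m₂₇` of `x₀ = Re q` on `SU(2) ≅ S³`.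
* `Z_bracket4`, `Zp_bracket4`, `zB_bracket4`, `m2_bracket4`: the `N = 20` symbolic brackets (explicit polynomials of degree
  `≤ 19` in `κ`, tail `(5460/100) κ²⁰/20! = 1 * κ²⁰ / 44558644838400000`) of `Z = ∫ e^{κx₀}`, `Z' = ∫ x₀e^{κx₀}`,
  `z_B = ∫₀¹r³∫e^{κrx₀}`, `m₂ = ∫₀¹r⁵∫e^{κrx₀}` on `0 ≤ κ ≤ 4`.
The companion `BallSeriesFour` brackets the fourteen further ball moments of the rung-2/3 polynomial flux witness; the piece
files `BallPieceFour*` consume both.  Generator: engine-2 folder `leanwork/gen_brackets_four.py`.  No number of any ledger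
moves in this file.
-/

noncomputable section

open MeasureTheory Filter Finset Real intervalIntegral
open scoped NNReal Quaternion Matrix BigOperators Topology Nat
open Matrix Complex
open Literature.MathematicalPhysics.QuantumLattice (su2Quat)
open Literature.MathematicalPhysics.QuantumFieldTheory
open Literature.MathematicalPhysics.QuantumFieldTheory.Balaban1983to89.StrongCouplingVarianceWindow
  (integral_re_pow_odd)
open Summit.QuantumFields.BalabanUV.InfraRed.StrongCouplingHaarMoments (hasSum_integral_pow_mul_exp
  integral_re_pow_add_two)
open Summit.QuantumFields.BalabanUV.InfraRed.StrongCouplingBallSeries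
open Summit.QuantumFields.BalabanUV.InfraRed.StrongCouplingEightFifthsBrackets (partial_mono)
open Summit.Ventures.YMGap.BallBracketsThree (moments_three)

namespace Summit.Ventures.YMGap.BallBracketsFour

/-! ## 1. Series brackets on `0 ≤ κ ≤ 4` -/

/-- **`e^κ ≤ 5460/100` on the range `κ ≤ 4`** (`e < 2.7182818286`, to the fourth). [folklore] -/
theorem exp_le_of_le_four {κ : ℝ} (hκ : κ ≤ 4) : Real.exp κ ≤ 5460 / 100 := by
  have h1 := Real.exp_one_lt_d9
  have h0 : 0 ≤ Real.exp 1 := (Real.exp_pos 1).le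
  have e : Real.exp 4 = Real.exp 1 ^ 4 := by
    rw [show (4 : ℝ) = 1 + 1 + 1 + 1 by norm_num, Real.exp_add, Real.exp_add, Real.exp_add]; ring
  have h2 : Real.exp 1 ^ 4 ≤ (2.7182818286 : ℝ) ^ 4 := pow_le_pow_left₀ h0 h1.le 4
  have h3 : Real.exp 4 ≤ 5460 / 100 := by rw [e]; exact h2.trans (by norm_num)
  exact (Real.exp_le_exp.2 hκ).trans h3

/-- The upper bracket as a function of `κ ∈ [0, 4]`: `S ≤ Σ_{n<N} x_n κ^n + (5460/100) κ^N / N!`. [folklore] -/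
theorem le_partial_add_of_hasSum4 {x : ℕ → ℝ} {κ S : ℝ} (hκ : 0 ≤ κ) (hκ' : κ ≤ 4)
    (hx : ∀ n, x n ≤ 1 / n !) (h : HasSum (fun n => x n * κ ^ n) S) (N : ℕ) :
    S ≤ ∑ n ∈ range N, x n * κ ^ n + 5460 / 100 * κ ^ N / N ! := by
  have h1 := le_partial_add_of_hasSum hκ hx h N
  have h3 : κ ^ N * Real.exp κ / N ! ≤ 5460 / 100 * κ ^ N / N ! := by
    have hN : (0 : ℝ) < N ! := by positivity
    rw [div_le_div_iff₀ hN hN]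
    refine mul_le_mul_of_nonneg_right ?_ hN.le
    rw [mul_comm]
    exact mul_le_mul_of_nonneg_right (exp_le_of_le_four hκ') (pow_nonneg hκ N)
  linarith

/-- Monotonicity of the evaluated bracket: `Σ_{n<N} x_n κ^n + (5460/100)κ^N/N! ≤ Σ_{n<N} x_n K^n + (5460/100)K^N/N!`
for `0 ≤ κ ≤ K`, `x_n ≥ 0`. [folklore] -/
theorem partial_add_mono4 {x : ℕ → ℝ} {κ K : ℝ} (hκ : 0 ≤ κ) (hκK : κ ≤ K) (hx0 : ∀ n, 0 ≤ x n) (N : ℕ) :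
    ∑ n ∈ range N, x n * κ ^ n + 5460 / 100 * κ ^ N / N ! ≤
      ∑ n ∈ range N, x n * K ^ n + 5460 / 100 * K ^ N / N ! := by
  have h2 : ∑ n ∈ range N, x n * κ ^ n ≤ ∑ n ∈ range N, x n * K ^ n :=
    sum_le_sum fun n _ => mul_le_mul_of_nonneg_left (pow_le_pow_left₀ hκ hκK n) (hx0 n)
  have h3 : 5460 / 100 * κ ^ N / N ! ≤ 5460 / 100 * K ^ N / N ! :=
    div_le_div_of_nonneg_right (mul_le_mul_of_nonneg_left (pow_le_pow_left₀ hκ hκK N) (by norm_num))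
      (by positivity)
  linarith

/-- **Two-sided bracket of an exponential (sphere) moment** on `0 ≤ κ ≤ 4`:
`Σ_{n<N} κ^n/n! m_{k+n} ≤ ∫ x₀^k e^{κ x₀} dσ ≤ (same sum) + (5460/100) κ^N/N!`. [folklore] -/
theorem sphere_bracket4 (k : ℕ) {κ : ℝ} (hκ : 0 ≤ κ) (hκ' : κ ≤ 4) (N : ℕ) :
    ∑ n ∈ range N, κ ^ n / n ! * ∫ g : Matrix.specialUnitaryGroup (Fin 2) ℂ, (su2Quat g).re ^ (k + n) ∂(haarProbability (Matrix.specialUnitaryGroup (Fin 2) ℂ))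
      ≤ ∫ g : Matrix.specialUnitaryGroup (Fin 2) ℂ, (su2Quat g).re ^ k * Real.exp (κ * (su2Quat g).re) ∂(haarProbability (Matrix.specialUnitaryGroup (Fin 2) ℂ)) ∧
    ∫ g : Matrix.specialUnitaryGroup (Fin 2) ℂ, (su2Quat g).re ^ k * Real.exp (κ * (su2Quat g).re) ∂(haarProbability (Matrix.specialUnitaryGroup (Fin 2) ℂ))
      ≤ ∑ n ∈ range N, κ ^ n / n ! * ∫ g : Matrix.specialUnitaryGroup (Fin 2) ℂ, (su2Quat g).re ^ (k + n) ∂(haarProbability (Matrix.specialUnitaryGroup (Fin 2) ℂ)) + 5460 / 100 * κ ^ N / N ! := by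
  have h := hasSum_integral_pow_mul_exp k κ
  have h' : HasSum (fun n : ℕ => (1 / (n ! * 1) * ∫ g : Matrix.specialUnitaryGroup (Fin 2) ℂ, (su2Quat g).re ^ (k + n) ∂(haarProbability (Matrix.specialUnitaryGroup (Fin 2) ℂ))) * κ ^ n)
      (∫ g : Matrix.specialUnitaryGroup (Fin 2) ℂ, (su2Quat g).re ^ k * Real.exp (κ * (su2Quat g).re) ∂(haarProbability (Matrix.specialUnitaryGroup (Fin 2) ℂ))) := by
    convert h using 1; funext n; ring
  have hlo := partial_le_of_hasSum hκ (fun n => (coeff_mem k n le_rfl).1) h' N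
  have hhi := le_partial_add_of_hasSum4 hκ hκ' (fun n => (coeff_mem k n le_rfl).2) h' N
  have e : ∑ n ∈ range N, (1 / (n ! * 1) * ∫ g : Matrix.specialUnitaryGroup (Fin 2) ℂ, (su2Quat g).re ^ (k + n) ∂(haarProbability (Matrix.specialUnitaryGroup (Fin 2) ℂ))) * κ ^ n =
      ∑ n ∈ range N, κ ^ n / n ! * ∫ g : Matrix.specialUnitaryGroup (Fin 2) ℂ, (su2Quat g).re ^ (k + n) ∂(haarProbability (Matrix.specialUnitaryGroup (Fin 2) ℂ)) := sum_congr rfl fun n _ => by ring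
  rw [e] at hlo hhi
  exact ⟨hlo, hhi⟩

/-- **Evaluated sphere bracket on a piece**: for `0 ≤ t ≤ κ ≤ K ≤ 4`,
`Σ_{n<N} t^n/n! m_{k+n} ≤ ∫ x₀^k e^{κ x₀} dσ ≤ Σ_{n<N} K^n/n! m_{k+n} + (5460/100) K^N/N!`. [folklore] -/
theorem sphere_eval4 (k : ℕ) {t κ K : ℝ} (ht : 0 ≤ t) (htκ : t ≤ κ) (hκK : κ ≤ K) (hK : K ≤ 4) (N : ℕ) :
    ∑ n ∈ range N, t ^ n / n ! * ∫ g : Matrix.specialUnitaryGroup (Fin 2) ℂ, (su2Quat g).re ^ (k + n) ∂(haarProbability (Matrix.specialUnitaryGroup (Fin 2) ℂ))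
      ≤ ∫ g : Matrix.specialUnitaryGroup (Fin 2) ℂ, (su2Quat g).re ^ k * Real.exp (κ * (su2Quat g).re) ∂(haarProbability (Matrix.specialUnitaryGroup (Fin 2) ℂ)) ∧
    ∫ g : Matrix.specialUnitaryGroup (Fin 2) ℂ, (su2Quat g).re ^ k * Real.exp (κ * (su2Quat g).re) ∂(haarProbability (Matrix.specialUnitaryGroup (Fin 2) ℂ))
      ≤ ∑ n ∈ range N, K ^ n / n ! * ∫ g : Matrix.specialUnitaryGroup (Fin 2) ℂ, (su2Quat g).re ^ (k + n) ∂(haarProbability (Matrix.specialUnitaryGroup (Fin 2) ℂ)) + 5460 / 100 * K ^ N / N ! := by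
  have hκ : 0 ≤ κ := ht.trans htκ
  obtain ⟨hlo, hhi⟩ := sphere_bracket4 k hκ (hκK.trans hK) N
  have hx0 : ∀ n : ℕ, 0 ≤ 1 / (n ! * 1) * ∫ g : Matrix.specialUnitaryGroup (Fin 2) ℂ, (su2Quat g).re ^ (k + n) ∂(haarProbability (Matrix.specialUnitaryGroup (Fin 2) ℂ)) :=
    fun n => (coeff_mem k n le_rfl).1
  have h1 := partial_mono ht htκ hx0 N
  have h2 := partial_add_mono4 hκ hκK hx0 N
  have e : ∀ s : ℝ, ∑ n ∈ range N, (1 / (n ! * 1) * ∫ g : Matrix.specialUnitaryGroup (Fin 2) ℂ, (su2Quat g).re ^ (k + n) ∂(haarProbability (Matrix.specialUnitaryGroup (Fin 2) ℂ))) * s ^ n =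
      ∑ n ∈ range N, s ^ n / n ! * ∫ g : Matrix.specialUnitaryGroup (Fin 2) ℂ, (su2Quat g).re ^ (k + n) ∂(haarProbability (Matrix.specialUnitaryGroup (Fin 2) ℂ)) :=
    fun s => sum_congr rfl fun n _ => by ring
  rw [e, e] at h1 h2
  exact ⟨h1.trans hlo, hhi.trans h2⟩

/-- **Two-sided bracket of a ball moment** on `0 ≤ κ ≤ 4`:
`Σ_{n<N} κ^n/(n!(n+a+1)) m_{k+n} ≤ ∫₀¹ r^a ∫ x₀^k e^{κ r x₀} dσ dr ≤ (same sum) + (5460/100) κ^N/N!`. [folklore] -/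
theorem ball_bracket4 (k a : ℕ) {κ : ℝ} (hκ : 0 ≤ κ) (hκ' : κ ≤ 4) (N : ℕ) :
    ∑ n ∈ range N, κ ^ n / (n ! * (n + a + 1)) * ∫ g : Matrix.specialUnitaryGroup (Fin 2) ℂ, (su2Quat g).re ^ (k + n) ∂(haarProbability (Matrix.specialUnitaryGroup (Fin 2) ℂ))
      ≤ ∫ r in (0:ℝ)..1, r ^ a * ∫ g : Matrix.specialUnitaryGroup (Fin 2) ℂ, (su2Quat g).re ^ k * Real.exp (κ * r * (su2Quat g).re) ∂(haarProbability (Matrix.specialUnitaryGroup (Fin 2) ℂ)) ∧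
    ∫ r in (0:ℝ)..1, r ^ a * ∫ g : Matrix.specialUnitaryGroup (Fin 2) ℂ, (su2Quat g).re ^ k * Real.exp (κ * r * (su2Quat g).re) ∂(haarProbability (Matrix.specialUnitaryGroup (Fin 2) ℂ))
      ≤ ∑ n ∈ range N, κ ^ n / (n ! * (n + a + 1)) * ∫ g : Matrix.specialUnitaryGroup (Fin 2) ℂ, (su2Quat g).re ^ (k + n) ∂(haarProbability (Matrix.specialUnitaryGroup (Fin 2) ℂ))
        + 5460 / 100 * κ ^ N / N ! := by
  have h := hasSum_ball k a κ
  have h' : HasSum (fun n : ℕ => (1 / (n ! * (n + a + 1)) * ∫ g : Matrix.specialUnitaryGroup (Fin 2) ℂ, (su2Quat g).re ^ (k + n) ∂(haarProbability (Matrix.specialUnitaryGroup (Fin 2) ℂ))) * κ ^ n)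
      (∫ r in (0:ℝ)..1, r ^ a * ∫ g : Matrix.specialUnitaryGroup (Fin 2) ℂ, (su2Quat g).re ^ k * Real.exp (κ * r * (su2Quat g).re) ∂(haarProbability (Matrix.specialUnitaryGroup (Fin 2) ℂ))) := by
    convert h using 1; funext n; ring
  have hw : ∀ n : ℕ, (1 : ℝ) ≤ n + a + 1 := fun n => by
    linarith [(Nat.cast_nonneg n : (0:ℝ) ≤ n), (Nat.cast_nonneg a : (0:ℝ) ≤ a)]
  have hlo := partial_le_of_hasSum hκ (fun n => (coeff_mem k n (hw n)).1) h' N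
  have hhi := le_partial_add_of_hasSum4 hκ hκ' (fun n => (coeff_mem k n (hw n)).2) h' N
  have e : ∑ n ∈ range N, (1 / (n ! * (n + a + 1)) * ∫ g : Matrix.specialUnitaryGroup (Fin 2) ℂ, (su2Quat g).re ^ (k + n) ∂(haarProbability (Matrix.specialUnitaryGroup (Fin 2) ℂ))) * κ ^ n =
      ∑ n ∈ range N, κ ^ n / (n ! * (n + a + 1)) * ∫ g : Matrix.specialUnitaryGroup (Fin 2) ℂ, (su2Quat g).re ^ (k + n) ∂(haarProbability (Matrix.specialUnitaryGroup (Fin 2) ℂ)) :=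
    sum_congr rfl fun n _ => by ring
  rw [e] at hlo hhi
  exact ⟨hlo, hhi⟩

/-- **Evaluated ball bracket on a piece**: for `0 ≤ t ≤ κ ≤ K ≤ 4`,
`Σ_{n<N} t^n/(n!(n+a+1)) m_{k+n} ≤ ∫₀¹ r^a ∫ x₀^k e^{κ r x₀} dσ dr ≤ Σ_{n<N} K^n/(n!(n+a+1)) m_{k+n} + (5460/100) K^N/N!`.
[folklore] -/
theorem ball_eval4 (k a : ℕ) {t κ K : ℝ} (ht : 0 ≤ t) (htκ : t ≤ κ) (hκK : κ ≤ K) (hK : K ≤ 4) (N : ℕ) :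
    ∑ n ∈ range N, t ^ n / (n ! * (n + a + 1)) * ∫ g : Matrix.specialUnitaryGroup (Fin 2) ℂ, (su2Quat g).re ^ (k + n) ∂(haarProbability (Matrix.specialUnitaryGroup (Fin 2) ℂ))
      ≤ ∫ r in (0:ℝ)..1, r ^ a * ∫ g : Matrix.specialUnitaryGroup (Fin 2) ℂ, (su2Quat g).re ^ k * Real.exp (κ * r * (su2Quat g).re) ∂(haarProbability (Matrix.specialUnitaryGroup (Fin 2) ℂ)) ∧
    ∫ r in (0:ℝ)..1, r ^ a * ∫ g : Matrix.specialUnitaryGroup (Fin 2) ℂ, (su2Quat g).re ^ k * Real.exp (κ * r * (su2Quat g).re) ∂(haarProbability (Matrix.specialUnitaryGroup (Fin 2) ℂ))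
      ≤ ∑ n ∈ range N, K ^ n / (n ! * (n + a + 1)) * ∫ g : Matrix.specialUnitaryGroup (Fin 2) ℂ, (su2Quat g).re ^ (k + n) ∂(haarProbability (Matrix.specialUnitaryGroup (Fin 2) ℂ))
        + 5460 / 100 * K ^ N / N ! := by
  have hκ : 0 ≤ κ := ht.trans htκ
  obtain ⟨hlo, hhi⟩ := ball_bracket4 k a hκ (hκK.trans hK) N
  have hw : ∀ n : ℕ, (1 : ℝ) ≤ n + a + 1 := fun n => by
    linarith [(Nat.cast_nonneg n : (0:ℝ) ≤ n), (Nat.cast_nonneg a : (0:ℝ) ≤ a)]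
  have hx0 : ∀ n : ℕ, 0 ≤ 1 / (n ! * (n + a + 1)) * ∫ g : Matrix.specialUnitaryGroup (Fin 2) ℂ, (su2Quat g).re ^ (k + n) ∂(haarProbability (Matrix.specialUnitaryGroup (Fin 2) ℂ)) :=
    fun n => (coeff_mem k n (hw n)).1
  have h1 := partial_mono ht htκ hx0 N
  have h2 := partial_add_mono4 hκ hκK hx0 N
  have e : ∀ s : ℝ, ∑ n ∈ range N, (1 / (n ! * (n + a + 1)) * ∫ g : Matrix.specialUnitaryGroup (Fin 2) ℂ, (su2Quat g).re ^ (k + n) ∂(haarProbability (Matrix.specialUnitaryGroup (Fin 2) ℂ))) * s ^ n =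
      ∑ n ∈ range N, s ^ n / (n ! * (n + a + 1)) * ∫ g : Matrix.specialUnitaryGroup (Fin 2) ℂ, (su2Quat g).re ^ (k + n) ∂(haarProbability (Matrix.specialUnitaryGroup (Fin 2) ℂ)) :=
    fun s => sum_congr rfl fun n _ => by ring
  rw [e, e] at h1 h2
  exact ⟨h1.trans hlo, hhi.trans h2⟩

/-- Every ball moment is non-negative on `0 ≤ κ ≤ 4` (empty partial sum). [folklore] -/
theorem ball_nonneg4 (k a : ℕ) {κ : ℝ} (hκ : 0 ≤ κ) (hκ' : κ ≤ 4) :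
    0 ≤ ∫ r in (0:ℝ)..1, r ^ a * ∫ g : Matrix.specialUnitaryGroup (Fin 2) ℂ, (su2Quat g).re ^ k * Real.exp (κ * r * (su2Quat g).re) ∂(haarProbability (Matrix.specialUnitaryGroup (Fin 2) ℂ)) := by
  simpa using (ball_bracket4 k a hκ hκ' 0).1

/-- Every sphere moment is non-negative on `0 ≤ κ ≤ 4` (empty partial sum). [folklore] -/
theorem sphere_nonneg4 (k : ℕ) {κ : ℝ} (hκ : 0 ≤ κ) (hκ' : κ ≤ 4) :
    0 ≤ ∫ g : Matrix.specialUnitaryGroup (Fin 2) ℂ, (su2Quat g).re ^ k * Real.exp (κ * (su2Quat g).re) ∂(haarProbability (Matrix.specialUnitaryGroup (Fin 2) ℂ)) := by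
  simpa using (sphere_bracket4 k hκ hκ' 0).1


/-! ## 2. The moment table `m₀ … m₂₇` -/

/-- The Haar moments `∫ x₀ⁿ dσ`, `n = 0 … 27`, of `SU(2)` (Catalan numbers `C_j/4^j`; odd moments vanish). [folklore] -/
theorem moments_four :
    (∫ g : Matrix.specialUnitaryGroup (Fin 2) ℂ, (su2Quat g).re ^ 0 ∂haarProbability (Matrix.specialUnitaryGroup (Fin 2) ℂ) = 1) ∧
    (∫ g : Matrix.specialUnitaryGroup (Fin 2) ℂ, (su2Quat g).re ^ 1 ∂haarProbability (Matrix.specialUnitaryGroup (Fin 2) ℂ) = 0) ∧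
    (∫ g : Matrix.specialUnitaryGroup (Fin 2) ℂ, (su2Quat g).re ^ 2 ∂haarProbability (Matrix.specialUnitaryGroup (Fin 2) ℂ) = 1 / 4) ∧
    (∫ g : Matrix.specialUnitaryGroup (Fin 2) ℂ, (su2Quat g).re ^ 3 ∂haarProbability (Matrix.specialUnitaryGroup (Fin 2) ℂ) = 0) ∧
    (∫ g : Matrix.specialUnitaryGroup (Fin 2) ℂ, (su2Quat g).re ^ 4 ∂haarProbability (Matrix.specialUnitaryGroup (Fin 2) ℂ) = 1 / 8) ∧
    (∫ g : Matrix.specialUnitaryGroup (Fin 2) ℂ, (su2Quat g).re ^ 5 ∂haarProbability (Matrix.specialUnitaryGroup (Fin 2) ℂ) = 0) ∧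
    (∫ g : Matrix.specialUnitaryGroup (Fin 2) ℂ, (su2Quat g).re ^ 6 ∂haarProbability (Matrix.specialUnitaryGroup (Fin 2) ℂ) = 5 / 64) ∧
    (∫ g : Matrix.specialUnitaryGroup (Fin 2) ℂ, (su2Quat g).re ^ 7 ∂haarProbability (Matrix.specialUnitaryGroup (Fin 2) ℂ) = 0) ∧
    (∫ g : Matrix.specialUnitaryGroup (Fin 2) ℂ, (su2Quat g).re ^ 8 ∂haarProbability (Matrix.specialUnitaryGroup (Fin 2) ℂ) = 7 / 128) ∧
    (∫ g : Matrix.specialUnitaryGroup (Fin 2) ℂ, (su2Quat g).re ^ 9 ∂haarProbability (Matrix.specialUnitaryGroup (Fin 2) ℂ) = 0) ∧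
    (∫ g : Matrix.specialUnitaryGroup (Fin 2) ℂ, (su2Quat g).re ^ 10 ∂haarProbability (Matrix.specialUnitaryGroup (Fin 2) ℂ) = 21 / 512) ∧
    (∫ g : Matrix.specialUnitaryGroup (Fin 2) ℂ, (su2Quat g).re ^ 11 ∂haarProbability (Matrix.specialUnitaryGroup (Fin 2) ℂ) = 0) ∧
    (∫ g : Matrix.specialUnitaryGroup (Fin 2) ℂ, (su2Quat g).re ^ 12 ∂haarProbability (Matrix.specialUnitaryGroup (Fin 2) ℂ) = 33 / 1024) ∧
    (∫ g : Matrix.specialUnitaryGroup (Fin 2) ℂ, (su2Quat g).re ^ 13 ∂haarProbability (Matrix.specialUnitaryGroup (Fin 2) ℂ) = 0) ∧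
    (∫ g : Matrix.specialUnitaryGroup (Fin 2) ℂ, (su2Quat g).re ^ 14 ∂haarProbability (Matrix.specialUnitaryGroup (Fin 2) ℂ) = 429 / 16384) ∧
    (∫ g : Matrix.specialUnitaryGroup (Fin 2) ℂ, (su2Quat g).re ^ 15 ∂haarProbability (Matrix.specialUnitaryGroup (Fin 2) ℂ) = 0) ∧
    (∫ g : Matrix.specialUnitaryGroup (Fin 2) ℂ, (su2Quat g).re ^ 16 ∂haarProbability (Matrix.specialUnitaryGroup (Fin 2) ℂ) = 715 / 32768) ∧
    (∫ g : Matrix.specialUnitaryGroup (Fin 2) ℂ, (su2Quat g).re ^ 17 ∂haarProbability (Matrix.specialUnitaryGroup (Fin 2) ℂ) = 0) ∧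
    (∫ g : Matrix.specialUnitaryGroup (Fin 2) ℂ, (su2Quat g).re ^ 18 ∂haarProbability (Matrix.specialUnitaryGroup (Fin 2) ℂ) = 2431 / 131072) ∧
    (∫ g : Matrix.specialUnitaryGroup (Fin 2) ℂ, (su2Quat g).re ^ 19 ∂haarProbability (Matrix.specialUnitaryGroup (Fin 2) ℂ) = 0) ∧
    (∫ g : Matrix.specialUnitaryGroup (Fin 2) ℂ, (su2Quat g).re ^ 20 ∂haarProbability (Matrix.specialUnitaryGroup (Fin 2) ℂ) = 4199 / 262144) ∧
    (∫ g : Matrix.specialUnitaryGroup (Fin 2) ℂ, (su2Quat g).re ^ 21 ∂haarProbability (Matrix.specialUnitaryGroup (Fin 2) ℂ) = 0) ∧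
    (∫ g : Matrix.specialUnitaryGroup (Fin 2) ℂ, (su2Quat g).re ^ 22 ∂haarProbability (Matrix.specialUnitaryGroup (Fin 2) ℂ) = 29393 / 2097152) ∧
    (∫ g : Matrix.specialUnitaryGroup (Fin 2) ℂ, (su2Quat g).re ^ 23 ∂haarProbability (Matrix.specialUnitaryGroup (Fin 2) ℂ) = 0) ∧
    (∫ g : Matrix.specialUnitaryGroup (Fin 2) ℂ, (su2Quat g).re ^ 24 ∂haarProbability (Matrix.specialUnitaryGroup (Fin 2) ℂ) = 52003 / 4194304) ∧
    (∫ g : Matrix.specialUnitaryGroup (Fin 2) ℂ, (su2Quat g).re ^ 25 ∂haarProbability (Matrix.specialUnitaryGroup (Fin 2) ℂ) = 0) ∧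
    (∫ g : Matrix.specialUnitaryGroup (Fin 2) ℂ, (su2Quat g).re ^ 26 ∂haarProbability (Matrix.specialUnitaryGroup (Fin 2) ℂ) = 185725 / 16777216) ∧
    (∫ g : Matrix.specialUnitaryGroup (Fin 2) ℂ, (su2Quat g).re ^ 27 ∂haarProbability (Matrix.specialUnitaryGroup (Fin 2) ℂ) = 0) := by
  obtain ⟨m0, m1, m2, m3, m4, m5, m6, m7, m8, m9, m10, m11, m12, m13, m14, m15, m16, m17, m18, m19, m20, m21⟩ := moments_three
  have m22 : ∫ g : Matrix.specialUnitaryGroup (Fin 2) ℂ, (su2Quat g).re ^ 22 ∂haarProbability (Matrix.specialUnitaryGroup (Fin 2) ℂ) = 29393 / 2097152 := by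
    have h := integral_re_pow_add_two 20
    norm_num at h
    rw [m20] at h
    rw [h]; norm_num
  have m23 : ∫ g : Matrix.specialUnitaryGroup (Fin 2) ℂ, (su2Quat g).re ^ 23 ∂haarProbability (Matrix.specialUnitaryGroup (Fin 2) ℂ) = 0 := by
    simpa using integral_re_pow_odd 11
  have m24 : ∫ g : Matrix.specialUnitaryGroup (Fin 2) ℂ, (su2Quat g).re ^ 24 ∂haarProbability (Matrix.specialUnitaryGroup (Fin 2) ℂ) = 52003 / 4194304 := by
    have h := integral_re_pow_add_two 22
    norm_num at h
    rw [m22] at h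
    rw [h]; norm_num
  have m25 : ∫ g : Matrix.specialUnitaryGroup (Fin 2) ℂ, (su2Quat g).re ^ 25 ∂haarProbability (Matrix.specialUnitaryGroup (Fin 2) ℂ) = 0 := by
    simpa using integral_re_pow_odd 12
  have m26 : ∫ g : Matrix.specialUnitaryGroup (Fin 2) ℂ, (su2Quat g).re ^ 26 ∂haarProbability (Matrix.specialUnitaryGroup (Fin 2) ℂ) = 185725 / 16777216 := by
    have h := integral_re_pow_add_two 24
    norm_num at h
    rw [m24] at h
    rw [h]; norm_num
  have m27 : ∫ g : Matrix.specialUnitaryGroup (Fin 2) ℂ, (su2Quat g).re ^ 27 ∂haarProbability (Matrix.specialUnitaryGroup (Fin 2) ℂ) = 0 := by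
    simpa using integral_re_pow_odd 13
  exact ⟨m0, m1, m2, m3, m4, m5, m6, m7, m8, m9, m10, m11, m12, m13, m14, m15, m16, m17, m18, m19, m20, m21, m22, m23, m24, m25, m26, m27⟩

/-! ## 3. Symbolic brackets on `0 ≤ κ ≤ 4` -/

/-- `Z = ∫ e^{κx₀} dσ` is bracketed by its degree-`18` Taylor polynomial on `0 ≤ κ ≤ 4` (tail `(5460/100)κ²⁰/20!`). [folklore] -/
theorem Z_bracket4 {κ : ℝ} (hκ : 0 ≤ κ) (hκ' : κ ≤ 4) :
    1 + κ ^ 2 / 8 + κ ^ 4 / 192 + κ ^ 6 / 9216 + κ ^ 8 / 737280 + κ ^ 10 / 88473600 + κ ^ 12 / 14863564800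
        + κ ^ 14 / 3329438515200 + κ ^ 16 / 958878292377600 + κ ^ 18 / 345196185255936000
      ≤ ∫ g : Matrix.specialUnitaryGroup (Fin 2) ℂ, Real.exp (κ * (su2Quat g).re) ∂(haarProbability (Matrix.specialUnitaryGroup (Fin 2) ℂ)) ∧
    ∫ g : Matrix.specialUnitaryGroup (Fin 2) ℂ, Real.exp (κ * (su2Quat g).re) ∂(haarProbability (Matrix.specialUnitaryGroup (Fin 2) ℂ))
      ≤ 1 + κ ^ 2 / 8 + κ ^ 4 / 192 + κ ^ 6 / 9216 + κ ^ 8 / 737280 + κ ^ 10 / 88473600 + κ ^ 12 / 14863564800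
        + κ ^ 14 / 3329438515200 + κ ^ 16 / 958878292377600 + κ ^ 18 / 345196185255936000
        + 1 * κ ^ 20 / 44558644838400000 := by
  have h := sphere_bracket4 0 hκ hκ' 20
  obtain ⟨m0, m1, m2, m3, m4, m5, m6, m7, m8, m9, m10, m11, m12, m13, m14, m15, m16, m17, m18, m19, -, -, -, -, -, -, -, -⟩ := moments_four
  simp only [sum_range_succ, sum_range_zero, Nat.reduceAdd, m0, m1, m2, m3, m4, m5, m6, m7, m8, m9, m10, m11, m12, m13, m14, m15, m16, m17, m18, m19,
    Nat.factorial, Nat.succ_eq_add_one, Nat.reduceMul, Nat.cast_ofNat, Nat.cast_one] at h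
  simp only [pow_zero, one_mul] at h
  norm_num at h
  constructor <;> linarith [h.1, h.2]

/-- `Z' = ∫ x₀ e^{κx₀} dσ` is bracketed by its degree-`19` Taylor polynomial on `0 ≤ κ ≤ 4`. [folklore] -/
theorem Zp_bracket4 {κ : ℝ} (hκ : 0 ≤ κ) (hκ' : κ ≤ 4) :
    κ / 4 + κ ^ 3 / 48 + κ ^ 5 / 1536 + κ ^ 7 / 92160 + κ ^ 9 / 8847360 + κ ^ 11 / 1238630400 + κ ^ 13 / 237817036800
        + κ ^ 15 / 59929893273600 + κ ^ 17 / 19177565847552000 + κ ^ 19 / 7594316075630592000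
      ≤ ∫ g : Matrix.specialUnitaryGroup (Fin 2) ℂ, (su2Quat g).re * Real.exp (κ * (su2Quat g).re) ∂(haarProbability (Matrix.specialUnitaryGroup (Fin 2) ℂ)) ∧
    ∫ g : Matrix.specialUnitaryGroup (Fin 2) ℂ, (su2Quat g).re * Real.exp (κ * (su2Quat g).re) ∂(haarProbability (Matrix.specialUnitaryGroup (Fin 2) ℂ))
      ≤ κ / 4 + κ ^ 3 / 48 + κ ^ 5 / 1536 + κ ^ 7 / 92160 + κ ^ 9 / 8847360 + κ ^ 11 / 1238630400 + κ ^ 13 / 237817036800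
        + κ ^ 15 / 59929893273600 + κ ^ 17 / 19177565847552000 + κ ^ 19 / 7594316075630592000
        + 1 * κ ^ 20 / 44558644838400000 := by
  have h := sphere_bracket4 1 hκ hκ' 20
  obtain ⟨-, m1, m2, m3, m4, m5, m6, m7, m8, m9, m10, m11, m12, m13, m14, m15, m16, m17, m18, m19, m20, -, -, -, -, -, -, -⟩ := moments_four
  simp only [sum_range_succ, sum_range_zero, Nat.reduceAdd, m1, m2, m3, m4, m5, m6, m7, m8, m9, m10, m11, m12, m13, m14, m15, m16, m17, m18, m19, m20,
    Nat.factorial, Nat.succ_eq_add_one, Nat.reduceMul, Nat.cast_ofNat, Nat.cast_one] at h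
  simp only [pow_one] at h
  norm_num at h
  constructor <;> linarith [h.1, h.2]

/-- `z_B = ∫₀¹ r³ ∫ e^{κrx₀} dσ dr` is bracketed by its degree-`18` polynomial on `0 ≤ κ ≤ 4`. [folklore] -/
theorem zB_bracket4 {κ : ℝ} (hκ : 0 ≤ κ) (hκ' : κ ≤ 4) :
    1 / 4 + κ ^ 2 / 48 + κ ^ 4 / 1536 + κ ^ 6 / 92160 + κ ^ 8 / 8847360 + κ ^ 10 / 1238630400 + κ ^ 12 / 237817036800
        + κ ^ 14 / 59929893273600 + κ ^ 16 / 19177565847552000 + κ ^ 18 / 7594316075630592000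
      ≤ ∫ r in (0:ℝ)..1, r ^ 3 * ∫ g : Matrix.specialUnitaryGroup (Fin 2) ℂ, Real.exp (κ * r * (su2Quat g).re) ∂(haarProbability (Matrix.specialUnitaryGroup (Fin 2) ℂ)) ∧
    ∫ r in (0:ℝ)..1, r ^ 3 * ∫ g : Matrix.specialUnitaryGroup (Fin 2) ℂ, Real.exp (κ * r * (su2Quat g).re) ∂(haarProbability (Matrix.specialUnitaryGroup (Fin 2) ℂ))
      ≤ 1 / 4 + κ ^ 2 / 48 + κ ^ 4 / 1536 + κ ^ 6 / 92160 + κ ^ 8 / 8847360 + κ ^ 10 / 1238630400 + κ ^ 12 / 237817036800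
        + κ ^ 14 / 59929893273600 + κ ^ 16 / 19177565847552000 + κ ^ 18 / 7594316075630592000
        + 1 * κ ^ 20 / 44558644838400000 := by
  have h := ball_bracket4 0 3 hκ hκ' 20
  obtain ⟨m0, m1, m2, m3, m4, m5, m6, m7, m8, m9, m10, m11, m12, m13, m14, m15, m16, m17, m18, m19, -, -, -, -, -, -, -, -⟩ := moments_four
  simp only [sum_range_succ, sum_range_zero, Nat.reduceAdd, m0, m1, m2, m3, m4, m5, m6, m7, m8, m9, m10, m11, m12, m13, m14, m15, m16, m17, m18, m19,
    Nat.factorial, Nat.succ_eq_add_one, Nat.reduceMul, Nat.cast_ofNat, Nat.cast_one] at h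
  simp only [pow_zero, one_mul] at h
  norm_num at h
  constructor <;> linarith [h.1, h.2]

/-- `m₂ = ∫₀¹ r⁵ ∫ e^{κrx₀} dσ dr` is bracketed by its degree-`18` polynomial on `0 ≤ κ ≤ 4`. [folklore] -/
theorem m2_bracket4 {κ : ℝ} (hκ : 0 ≤ κ) (hκ' : κ ≤ 4) :
    1 / 6 + κ ^ 2 / 64 + κ ^ 4 / 1920 + κ ^ 6 / 110592 + κ ^ 8 / 10321920 + κ ^ 10 / 1415577600
        + κ ^ 12 / 267544166400 + κ ^ 14 / 66588770304000 + κ ^ 16 / 21095322432307200 + κ ^ 18 / 8284708446142464000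
      ≤ ∫ r in (0:ℝ)..1, r ^ 5 * ∫ g : Matrix.specialUnitaryGroup (Fin 2) ℂ, Real.exp (κ * r * (su2Quat g).re) ∂(haarProbability (Matrix.specialUnitaryGroup (Fin 2) ℂ)) ∧
    ∫ r in (0:ℝ)..1, r ^ 5 * ∫ g : Matrix.specialUnitaryGroup (Fin 2) ℂ, Real.exp (κ * r * (su2Quat g).re) ∂(haarProbability (Matrix.specialUnitaryGroup (Fin 2) ℂ))
      ≤ 1 / 6 + κ ^ 2 / 64 + κ ^ 4 / 1920 + κ ^ 6 / 110592 + κ ^ 8 / 10321920 + κ ^ 10 / 1415577600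
        + κ ^ 12 / 267544166400 + κ ^ 14 / 66588770304000 + κ ^ 16 / 21095322432307200 + κ ^ 18 / 8284708446142464000
        + 1 * κ ^ 20 / 44558644838400000 := by
  have h := ball_bracket4 0 5 hκ hκ' 20
  obtain ⟨m0, m1, m2, m3, m4, m5, m6, m7, m8, m9, m10, m11, m12, m13, m14, m15, m16, m17, m18, m19, -, -, -, -, -, -, -, -⟩ := moments_four
  simp only [sum_range_succ, sum_range_zero, Nat.reduceAdd, m0, m1, m2, m3, m4, m5, m6, m7, m8, m9, m10, m11, m12, m13, m14, m15, m16, m17, m18, m19,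
    Nat.factorial, Nat.succ_eq_add_one, Nat.reduceMul, Nat.cast_ofNat, Nat.cast_one] at h
  simp only [pow_zero, one_mul] at h
  norm_num at h
  constructor <;> linarith [h.1, h.2]

end Summit.Ventures.YMGap.BallBracketsFour
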